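import Literature.NumberTheory.GaloisRepresentations.IdeleBrauerLocalInvariantsDictionary
import Literature.NumberTheory.GaloisRepresentations.IdeleBrauerReciprocity
import Literature.NumberTheory.GaloisRepresentations.GaloisCohomologyLayerInflationLimit
import Literature.NumberTheory.GaloisRepresentations.ContinuousH2OrderTwoCriterion
import Literature.NumberTheory.GaloisRepresentations.TateH2VanishingArchimedean
import Literature.NumberTheory.GaloisRepresentations.BrauerTower
import Literature.NumberTheory.GaloisCohomology.CorrectionAtPOfCharacterReal
import Literature.NumberTheory.GaloisCohomology.LocalInvariantMapEvaluation
import Literature.NumberTheory.GaloisCohomology.CyclicClassOfResEqZero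
import HarnessLib

/-!
# Brauer classes of a number field: finite layers, torsion, and the vanishing of almost all localisations
# of a class of `H²(Γ_K, μₙ)` (Serre, *Local Fields* X §4; *Galois Cohomology* II §1.2, II §6.1; Milne *ADT* I §4 Lemma 4.8)

Topic `NumberTheory/GaloisCohomology`; namespace `Literature.NumberTheory.GaloisCohomology`.  Theorems only (no definition,
no named fact, no instance; D-0026).  Bookkeeping between the tree's two dialects of the Brauer group of a number field `K`:
the absolute one, `Br(K) = H²(Γ_K, K̄ˣ) = galoisCohomology (units K) 2` with its localisations `galoisCohomology.localization`
(restriction along `Γ_{K_v} → Γ_K`, SAME coefficients) and the Kummer classes `H²(Γ_K, μₙ) → Br(K)`; and the finite-layer one,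
`H²(Gal(E/K), Eˣ)` with door-c5/c6's idèle invariants `IdeleCohomology.brauerLocalInv` (cell bsd-schneider).

* §1 `add_self_eq_zero_continuousCohomology_two_of_natCard_le_two` — **`2 · H²(G, X) = 0` for a (discrete) group of order
  `≤ 2` and ANY topological `G`-module `X`** (the normalised diagonal of `φ + φ` is the norm of the `c`-invariant normalised
  diagonal of `φ`; `twoCocycleClass_eq_zero_of_twoCocycleNormDiag_eq`); at an infinite place `w` of a number field:
  `add_self_eq_zero_continuousCohomology_two_infinitePlace` (`|Γ_{K_w}| ≤ 2`).
* §2 `exists_unitsAbsInfTwo_eq` — **every class of `Br(K)` is `unitsAbsInfTwo K E β`** for a finite Galois `E ⊆ K̄` read as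
  an abstract extension (`E : Type`), the form consumed by the idèle files (`exists_unitsInfTwo_eq` + independence of the
  embedded copy, `AlgHom.fieldRange_of_normal`); `exists_pos_natCast_zsmul_eq_zero` — **`Br(K)` is torsion**.
* §3 `resMu_eq_zero_of_map_kummer_eq_zero` — Kummer at an extension `L/K`: if the Brauer class of `c ∈ H²(Γ_K, μₙ)` dies in
  `Br(L) = H²(Γ_L, L̄ˣ)` then `Res_{L/K} c = 0` (`cohomologyMap_kummerι_resMu` + Hilbert 90 over `L`); consequences
  `localization_inl_eq_zero_of_localization_kummer_eq_add_self` (real/complex places: `loc_w κ(c) ∈ 2 · H²` ⟹ `loc_w c = 0`)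
  and `localization_inr_eq_zero_of_brauerLocalInv_eq_zero` (finite places, through the dictionary
  `localInv_brauerToIdele_eq_brauerInvariantEquiv`).
* §4 **`exists_finset_forall_localization_inr_eq_zero`** — for every `c ∈ H²(Γ_K, μₙ)` there is a finite set `S` of finite
  places off which `loc_v c = 0` (Milne I Lemma 4.8 in degree `2`: almost all local invariants of a Brauer class vanish,
  `IdeleCohomology.finite_support_brauerLocalInv`).

Written for crux K4 `SignedControlAtTwo` (stmt-BirchSwinnertonDyer-20309, `Summits/BirchSwinnertonDyer`; line `eulerchar`, stub
`stub_realThreeOrderTwoBase`): these are the glue lemmas of the proof that a Brauer class with trivial real localisations is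
twice a Brauer class.  HONEST FRAMING: textbook Galois cohomology; no case of BSD or of Poitou–Tate is proved here.

## References
* J.-P. Serre, *Local Fields*, GTM 67 (1979), Ch. X §4 Prop. 6 and Cor. (`Br(K) = ⋃ H²(E/K)`), VIII §4. [SerreLocalFields1979]
* J.-P. Serre, *Galois Cohomology* (1997), Ch. I §2.4, Ch. II §1.2 (Kummer), II §6.1. [SerreGaloisCohomology1997]
* J. S. Milne, *Arithmetic Duality Theorems*, 2nd ed. (2006), Ch. I §4 Lemma 4.8, Thm. 2.13. [MilneADT2006]
* J. W. S. Cassels, A. Fröhlich (eds.), *Algebraic Number Theory* (1967), Ch. VII (Tate) §7.3, §9.6. [CasselsFrohlichANT1967]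

## Tree search
`lean search 'exists_unitsInfTwo_eq|finite_support_brauerLocalInv|localization_inl_eq_zero_iff_resMu|two_nsmul_continuousCohomology'`:
the embedded-layer statement, the idèle-side finite support, the `μₙ`-dialect real dictionary and the `H¹` order-two vanishing exist;
the abstract-layer form, the torsion statement, the degree-`2` order-two vanishing and the absolute finite-support statement do not.
-/

noncomputable section

open CategoryTheory Function Field NumberField IsDedekindDomain
open scoped NumberField

namespace Literature.NumberTheory.GaloisCohomology

open _root_.TopRep _root_.ContinuousCohomology
open Literature.NumberTheory.GaloisRepresentations
open Literature.NumberTheory.GaloisRepresentations.DiscreteGaloisModule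
open Literature.AnabelianGeometry.AbsoluteAnabelian
open Literature.AnabelianGeometry.AbsoluteAnabelian.Prop121vii

/-! ### §1. `2 · H²(G, X) = 0` for a group of order `≤ 2` -/

section OrderTwo

variable {R : Type} [CommRing R] [TopologicalSpace R]
variable {G : Type} [Group G] [TopologicalSpace G] [IsTopologicalGroup G]

/-- **`z + z = 0` for every `z ∈ H²(G, X)`, `G` discrete of order `≤ 2`, `X` any topological `G`-module** (Serre,
*Local Fields* VIII §4: `H²(G, X) ≅ X^G/(1 + c)X` is killed by `2`; for `G` trivial every class vanishes).  On cocycles: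
the normalised diagonal `x = φ(c,c) - cφ(1,1)` of `φ` is `c`-invariant, so that of `φ + φ` is the norm `x + c x`.
[cite: SerreLocalFields1979, VIII §4] [cite: MilneADT2006, Ch. I, Thm. 2.13] -/
theorem add_self_eq_zero_continuousCohomology_two_of_natCard_le_two [Finite G] [DiscreteTopology G]
    (hG : Nat.card G ≤ 2) (X : TopRep.{0} R G) (z : continuousCohomology 2 X) : z + z = 0 := by
  classical
  obtain ⟨φ, rfl⟩ := twoCocycleClass_surjective X z
  rw [← twoCocycleClass_add]
  by_cases h : ∃ c : G, c ≠ 1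
  · obtain ⟨c, hc⟩ := h
    refine twoCocycleClass_eq_zero_of_twoCocycleNormDiag_eq hG hc (φ + φ) (y := twoCocycleNormDiag c φ) ?_
    rw [twoCocycleNormDiag_add, rho_twoCocycleNormDiag (mul_self_eq_one_of_natCard_le_two hG c)]
  · -- `G` is trivial: every cocycle is the coboundary of the constant cochain `φ(1,1)`
    push Not at h
    rw [twoCocycleClass_eq_zero_iff]
    refine ⟨⟨fun _ => (φ + φ).1 (1, 1), continuous_const⟩, fun σ τ => ?_⟩
    rw [h σ, h τ, mul_one]
    change (φ + φ).1 (1, 1) = X.ρ 1 ((φ + φ).1 (1, 1)) - (φ + φ).1 (1, 1) + (φ + φ).1 (1, 1)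
    rw [map_one]
    change (φ + φ).1 (1, 1) = (φ + φ).1 (1, 1) - (φ + φ).1 (1, 1) + (φ + φ).1 (1, 1)
    abel

end OrderTwo

section Infinite

variable {K : Type} [Field K] [NumberField K]

omit [NumberField K] in
/-- **`z + z = 0` for every `z ∈ H²(Γ_{K_w}, X)` at an infinite place `w`** of a number field (`|Γ_{K_w}| ≤ 2`:
`K_w ≅ ℝ` or `ℂ`), for every topological `Γ_{K_w}`-module `X`. [cite: SerreLocalFields1979, VIII §4]
[cite: MilneADT2006, Ch. I, Thm. 2.13] -/
theorem add_self_eq_zero_continuousCohomology_two_infinitePlace (w : InfinitePlace K)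
    (X : TopRep.{0} ℤ (absoluteGaloisGroup w.Completion)) (z : continuousCohomology 2 X) : z + z = 0 := by
  haveI := finite_absoluteGaloisGroup_completion_infinitePlace w
  exact add_self_eq_zero_continuousCohomology_two_of_natCard_le_two
    (natCard_absoluteGaloisGroup_completion_infinitePlace_le_two w) X z

end Infinite

/-! ### §2. Every Brauer class comes from a finite layer; `Br(K)` is torsion -/

section Layer

variable (K : Type) [Field K] [CharZero K]

omit [CharZero K] in
/-- The embedded copy of the subtype of a normal intermediate field is the field itself (the image of a `K`-embedding of
a normal extension does not depend on the embedding). [cite: SerreLocalFields1979, Ch. XI §1 (iv)] -/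
private theorem embeddedField_coe_eq (E : IntermediateField K (AlgebraicClosure K)) [FiniteDimensional K E] [Normal K E] :
    embeddedField K E = E := by
  have h := AlgHom.fieldRange_of_normal (embeddingToAbs K E)
  rw [AlgHom.fieldRange_eq_map] at h
  exact h

omit [CharZero K] in
/-- Restrictions to equal subgroups vanish together. [folklore] -/
private theorem resH_eq_zero_iff_of_eq {S₁ S₂ : Subgroup (absoluteGaloisGroup K)} (h : S₁ = S₂)
    (x : galoisCohomology (units K) 2) :
    (resH S₁ (units K) 2).hom x = 0 ↔ (resH S₂ (units K) 2).hom x = 0 := by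
  subst h
  exact Iff.rfl

/-- **Every class of `Br(K) = H²(Γ_K, K̄ˣ)` is `unitsAbsInfTwo K E β`** — the inflation of a class of `H²(Gal(E/K), Eˣ)` for
a finite Galois `E ⊆ K̄`, `E` read as an ABSTRACT extension of `K` (the form consumed by the idèle-class files).  From
`exists_unitsInfTwo_eq` (`Br(K) = ⋃_E Br(E/K)`): the embedded copy of `E` is `E` again, so the two inflations have the same
image `ker(res_{Γ_E})`. [cite: SerreLocalFields1979, Ch. X §4 Prop. 6 and Cor.] [cite: SerreGaloisCohomology1997, I §2.2 Cor. 1 to Prop. 8] -/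
theorem exists_unitsAbsInfTwo_eq (u : galoisCohomology (units K) 2) :
    ∃ (E : IntermediateField K (AlgebraicClosure K)) (_ : FiniteDimensional K E) (_ : IsGalois K E)
      (β : groupCohomology (Rep.ofAlgebraAutOnUnits K E) 2), unitsAbsInfTwo K E β = u := by
  obtain ⟨E, hfd, hgal, x, hx⟩ := exists_unitsInfTwo_eq K u
  haveI := hfd
  haveI := hgal
  refine ⟨E, hfd, hgal, ?_⟩
  -- `u ∈ range (unitsInfTwo K (embeddedField K E))`, the two fixing subgroups being equal
  have hE : embeddedField K E = E := embeddedField_coe_eq K E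
  have hS : absGaloisFixingSubgroup (embeddedField K E) = absGaloisFixingSubgroup E :=
    Subgroup.ext fun σ => by
      rw [mem_absGaloisFixingSubgroup_iff, mem_absGaloisFixingSubgroup_iff]
      exact ⟨fun h y hy => h y (by rw [hE]; exact hy), fun h y hy => h y (by rw [hE] at hy; exact hy)⟩
  have h1 : (resH (absGaloisFixingSubgroup E) (units K) 2).hom u = 0 := (mem_range_unitsInfTwo_iff K E u).1 ⟨x, hx⟩
  have h2 : (resH (absGaloisFixingSubgroup (embeddedField K E)) (units K) 2).hom u = 0 :=
    (resH_eq_zero_iff_of_eq K hS u).2 h1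
  have hmem : u ∈ Set.range (unitsInfTwo K (embeddedField K E)) := (mem_range_unitsInfTwo_iff K _ u).2 h2
  obtain ⟨y, hy⟩ := hmem
  obtain ⟨β, rfl⟩ := UnitsLayer.unitsCohomologyIso_hom_surjective (embeddedEquiv K E) 2 y
  exact ⟨β, by rw [unitsAbsInfTwo_apply, hy]⟩

/-- **`Br(K)` is a torsion group**: every class of `H²(Γ_K, K̄ˣ)` is killed by a positive integer (the degree of a finite
Galois layer it comes from; `Hⁿ⁺¹` of a finite group is killed by its order).
[cite: SerreLocalFields1979, Ch. X §4 Prop. 6 and Cor.] [cite: SerreGaloisCohomology1997, I §2.4 Cor. 3 to Prop. 9] -/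
theorem exists_pos_natCast_zsmul_eq_zero (u : galoisCohomology (units K) 2) : ∃ N : ℕ, 0 < N ∧ (N : ℤ) • u = 0 := by
  obtain ⟨E, hfd, hgal, β, rfl⟩ := exists_unitsAbsInfTwo_eq K u
  haveI := hfd
  haveI := hgal
  refine ⟨Nat.card (E ≃ₐ[K] E), Nat.card_pos, ?_⟩
  rw [natCast_zsmul, ← map_nsmul, Literature.Algebra.Homology.card_smul_eq_zero_groupCohomology_succ _ 1 β, map_zero]

end Layer

/-! ### §3. Kummer at an extension: a `μₙ`-class whose Brauer class dies over `L` restricts to `0` over `L` -/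

section KummerBridge

variable (K : Type) [Field K] [CharZero K] {n : ℕ} [NeZero n]

omit [CharZero K] in
/-- **If the Brauer class `κ(c)` of `c ∈ H²(Γ_K, μₙ)` restricts to `0` in `Br(L) = H²(Γ_L, L̄ˣ)` (restriction along
`Γ_L → Γ_K` with the coefficients pushed along `K̄ → L̄`, any standard units morphism `φ`), then `Res_{L/K} c = 0` in
`H²(Γ_L, μₙ(L̄))`** — naturality of the Kummer map (`cohomologyMap_kummerι_resMu`) and its injectivity over `L` (Hilbert 90).
[cite: SerreGaloisCohomology1997, I §2.4 and II §1.2] -/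
theorem resMu_eq_zero_of_map_kummer_eq_zero (L : Type) [Field L] [Algebra K L] [CharZero L]
    (φ : TopRep.res ((absGaloisRestrict K L : absoluteGaloisGroup L →ₜ* absoluteGaloisGroup K) :
        absoluteGaloisGroup L →* absoluteGaloisGroup K) (units K).toTopRep ⟶ (units L).toTopRep)
    (hφ : ∀ u : (AlgebraicClosure K)ˣ, φ.hom (UnitsCarrier.ofUnits u) =
      UnitsCarrier.ofUnits (Units.map (absClosureEmbedding K L : AlgebraicClosure K →* AlgebraicClosure L) u))
    (c : galoisCohomology (mu K n) 2)
    (h : (ContinuousCohomology.map (absGaloisRestrict K L) φ 2).hom ((cohomologyMap (kummerι K n) 2).hom c) = 0) :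
    resMu K L n 2 c = 0 := by
  apply cohomologyMap_kummerι_two_injective L
  change (cohomologyMap (kummerι L n) 2).hom (resMu K L n 2 c) = (cohomologyMap (kummerι L n) 2).hom 0
  rw [map_zero, cohomologyMap_kummerι_resMu K L n φ hφ 2 c]
  exact h

variable {K}
variable [NumberField K]

omit [CharZero K] in
/-- **Localisation with the SAME coefficients followed by the change of coefficients IS the localisation with changed
coefficients**: for a place `v`, a standard units morphism `φ : K̄ˣ| → K̄_vˣ` over `Γ_{K_v} → Γ_K`, and `u ∈ Br(K)`,
`H²(res_v, φ) u = H²(id, φ) (loc_v u)` (one compatible pair, Mathlib `ContinuousCohomology.map_comp`).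
[cite: SerreGaloisCohomology1997, I §2.4] -/
theorem map_units_eq_map_localization (v : Place K)
    (φ : TopRep.res ((absGaloisRestrict K (Place.Completion v) :
        absoluteGaloisGroup (Place.Completion v) →ₜ* absoluteGaloisGroup K) :
        absoluteGaloisGroup (Place.Completion v) →* absoluteGaloisGroup K) (units K).toTopRep ⟶
        (units (Place.Completion v)).toTopRep)
    (u : galoisCohomology (units K) 2) :
    (ContinuousCohomology.map (absGaloisRestrict K (Place.Completion v)) φ 2).hom u =
      (ContinuousCohomology.map (ContinuousMonoidHom.id _)
        (X := ((units K).toLocal v).toTopRep) (Y := (units (Place.Completion v)).toTopRep)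
        (TopRep.ofHom ⟨φ.hom.toContinuousLinearMap, fun σ => φ.hom.isIntertwining' σ⟩) 2).hom
        (galoisCohomology.localization (units K) v 2 u) := by
  change ContinuousCohomology.map (absGaloisRestrict K (Place.Completion v)) φ 2 u =
    ContinuousCohomology.map (ContinuousMonoidHom.id _)
      (X := ((units K).toLocal v).toTopRep) (Y := (units (Place.Completion v)).toTopRep)
      (TopRep.ofHom ⟨φ.hom.toContinuousLinearMap, fun σ => φ.hom.isIntertwining' σ⟩) 2
      (ContinuousCohomology.map (absGaloisRestrict K (Place.Completion v)) (X := (units K).toTopRep)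
        (Y := ((units K).toLocal v).toTopRep) (TopRep.ofHom ⟨ContinuousLinearMap.id ℤ (UnitsCarrier K), fun _ => rfl⟩) 2 u)
  exact map_comp_apply_of (absGaloisRestrict K (Place.Completion v)) (ContinuousMonoidHom.id _)
    (absGaloisRestrict K (Place.Completion v)) (fun _ => rfl) _ _ _ (fun _ => rfl) 2 u

/-- **Real (and complex) places: if `loc_w κ(c)` is twice a class of `H²(Γ_{K_w}, K̄ˣ|)` then `loc_w c = 0`** for
`c ∈ H²(Γ_K, μₙ)` and an infinite place `w` — `2 · H²(Γ_{K_w}, ·) = 0`, so the Brauer class of `c` dies over `K_w`; Kummer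
over `K_w` (`resMu_eq_zero_of_map_kummer_eq_zero`) and the real dictionary `localization_inl_eq_zero_iff_resMu_eq_zero`.
[cite: SerreGaloisCohomology1997, II §1.2 and II §6.1] [cite: MilneADT2006, Ch. I, Thm. 2.13] -/
theorem localization_inl_eq_zero_of_localization_kummer_eq_add_self (w : InfinitePlace K) (c : galoisCohomology (mu K n) 2)
    (h : ∃ u' : galoisCohomology ((units K).toLocal (Sum.inl w)) 2,
      galoisCohomology.localization (units K) (Sum.inl w) 2 ((cohomologyMap (kummerι K n) 2).hom c) = u' + u') :
    galoisCohomology.localization (mu K n) (Sum.inl w) 2 c = 0 := by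
  haveI : CharZero w.Completion := charZero_of_injective_algebraMap (algebraMap K w.Completion).injective
  rw [localization_inl_eq_zero_iff_resMu_eq_zero]
  obtain ⟨φ, hφ⟩ := exists_unitsHom (F := K) w.Completion
  refine resMu_eq_zero_of_map_kummer_eq_zero K w.Completion φ hφ c ?_
  obtain ⟨u', hu'⟩ := h
  have h2 : u' + u' = 0 := add_self_eq_zero_continuousCohomology_two_infinitePlace w _ u'
  have key := map_units_eq_map_localization (Sum.inl w) φ ((cohomologyMap (kummerι K n) 2).hom c)
  rw [hu', h2] at key
  exact key.trans (map_zero _)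

/-- **Finite places: if door-c5's idèle invariant `brauerLocalInv E v β` of a layer representative `β` of `κ(c)` vanishes,
then `loc_v c = 0`** (`c ∈ H²(Γ_K, μₙ)`, `κ(c) = unitsAbsInfTwo K E β`): the dictionary
`localInv_brauerToIdele_eq_brauerInvariantEquiv` (the idèle invariant IS `inv_{K_v}` of the localised class), injectivity of
`inv_{K_v}`, Kummer over `K_v`, and `localInvariantMap_localization` with the bijectivity of `inv_v` on `H²(Γ_{K_v}, μₙ|)`.
[cite: CasselsFrohlichANT1967, Ch. VII §7.3 Cor. 7.4 (b)] [cite: SerreLocalFields1979, Ch. XIII §3 Prop. 6] -/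
theorem localization_inr_eq_zero_of_brauerLocalInv_eq_zero {E : Type} [Field E] [NumberField E] [Algebra K E] [IsGalois K E]
    (β : groupCohomology (Rep.ofAlgebraAutOnUnits K E) 2) (c : galoisCohomology (mu K n) 2)
    (hc : unitsAbsInfTwo K E β = (cohomologyMap (kummerι K n) 2).hom c) (v : HeightOneSpectrum (𝓞 K))
    (hv : IdeleCohomology.brauerLocalInv E v β = 0) :
    galoisCohomology.localization (mu K n) (Sum.inr v) 2 c = 0 := by
  haveI : CharZero (v.adicCompletion K) := LocalField.charZero_adicCompletion v
  obtain ⟨φ, hφ⟩ := exists_unitsHom (F := K) (v.adicCompletion K)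
  -- the localised Brauer class dies over `K_v`
  have h1 : (ContinuousCohomology.map (absGaloisRestrict K (v.adicCompletion K)) φ 2).hom
      ((cohomologyMap (kummerι K n) 2).hom c) = 0 := by
    rw [← hc]
    refine (AddEquiv.map_eq_zero_iff (brauerInvariantEquiv (v.adicCompletion K))).1 ?_
    rw [← IdeleCohomology.localInv_brauerToIdele_eq_brauerInvariantEquiv v φ hφ β, ← IdeleCohomology.brauerLocalInv_apply]
    exact hv
  have h2 : resMu K (v.adicCompletion K) n 2 c = 0 := resMu_eq_zero_of_map_kummer_eq_zero K _ φ hφ c h1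
  apply (localInvariantMap_bijective (K := K) (n := n) v).1
  rw [map_zero, localInvariantMap_localization, h2, map_zero]

end KummerBridge

/-! ### §4. Almost all localisations of a class of `H²(Γ_K, μₙ)` vanish -/

section FiniteSupport

variable (K : Type) [Field K] [NumberField K] {n : ℕ} [NeZero n]

/-- **For every `c ∈ H²(Γ_K, μₙ)` there is a finite set `S` of finite places with `loc_v c = 0` for all `v ∉ S`**
(Milne, *ADT* I Lemma 4.8, degree `2`: the Brauer class of `c` comes from a finite layer `E/K` and almost all of its idèle
invariants vanish, `IdeleCohomology.finite_support_brauerLocalInv`; then §3).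
[cite: MilneADT2006, Ch. I §4, Lemma 4.8] [cite: CasselsFrohlichANT1967, Ch. VII §7.3] -/
theorem exists_finset_forall_localization_inr_eq_zero (c : galoisCohomology (mu K n) 2) :
    ∃ S : Finset (HeightOneSpectrum (𝓞 K)), ∀ v ∉ S, galoisCohomology.localization (mu K n) (Sum.inr v) 2 c = 0 := by
  classical
  obtain ⟨E, hfd, hgal, β, hβ⟩ := exists_unitsAbsInfTwo_eq K ((cohomologyMap (kummerι K n) 2).hom c)
  haveI := hfd
  haveI := hgal
  haveI : NumberField E := NumberField.of_module_finite K E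
  refine ⟨(IdeleCohomology.finite_support_brauerLocalInv β).toFinset, fun v hv => ?_⟩
  rw [Set.Finite.mem_toFinset, Function.mem_support, not_not] at hv
  exact localization_inr_eq_zero_of_brauerLocalInv_eq_zero β c hβ v hv

end FiniteSupport

end Literature.NumberTheory.GaloisCohomology

end
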